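import Summits.BirchSwinnertonDyer.BirchSwinnertonDyer.Theorems.GenusKolyvaginAtTwoPowDvdShaCardAtTwoRTCrossPairTerm
import Summits.BirchSwinnertonDyer.BirchSwinnertonDyer.Theorems.GenusKolyvaginAtTwoPowDvdShaCardAtTwoPosTTranspositionFrame
import HarnessLib

/-!
# Route `GenusKolyvaginAtTwo`, crux L⁺_T `PowDvdShaCardAtTwoPosT` (stmt-BirchSwinnertonDyer-23379), road (E4)⁺, stub X-ORTH⁺ —
# THE CROSS LOCAL TERM OF McCALLUM'S PROP. 4.7 IS ZERO AT A TRANSPOSITION-DEEP KOLYVAGIN PLACE (sign-free twins of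
# `…RTCrossSignLocalVanishing` §3, `…RTCrossPairVanishing` §3 and `…RTCrossPairTerm` §1)

Seat `bsd-line-gk2-p2` g22 (PROVER seat 2/3, cell `bsd-f1-sign2`), `--supports stmt-BirchSwinnertonDyer-23379` (helper; closes nothing).
THEOREMS ONLY (no definition, no named fact, no `sorry`).  BSD is NOT proved by any of this; neither is L⁺_T nor any stub.

WHY (memo `Cruxes/KolyvaginExactAtTwoPosDiscT/RESTATEMENT-R9L-posdisc-lower-gk2p2.md`; LEAD R9).  Road (E4)'s X-ORTH socket — «the level-`2^k`
Cassels–Tate pairing of a (+)-provenance and a (−)-provenance Kolyvagin Ш-class vanishes» — is a sum of local terms (McCallum Prop. 4.7) of which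
only the CROSS terms (a Kolyvagin place of the first class not dividing the level of the second) need an argument; gk2-p4 g20 proved they vanish on
`Δ < 0` at Gross-class places (`…RTCrossSignLocalVanishing` §3 → `…RTCrossPairVanishing` §3 → `…RTCrossPairTerm` §1).  Those proofs use
`Δ < 0 ∧ FrobEqFrobInfty W K (2^M) ℓ` ONLY through the regular frame of the adapted lift (`exists_regular_frame_liftAutPlace`).  This file
re-runs them VERBATIM over the sign-free frame `exists_regular_frame_liftAutPlace_of_transposition` (`…PosTTranspositionFrame`, this seat): the
hypothesis pair `(hΔ, hF)` becomes the TRANSPOSITION clause «some Frobenius above `ℓ` moves a point of `E[2]`» (LINE 16_T's regular primes; on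
`Δ < 0` implied by Gross's (3.2), `transposition_of_frobEqFrobInfty_of_Δ_neg`), everything else unchanged:

* `invWeilPairing_kummer_localization_eq_zero_of_conjActPlace_add_zsmul_eq_transposition`, `…_of_opposite_signs_transposition` (§1),
* `…_of_level_eq_transposition`, `firstCase_localTerm_eq_zero_of_cross_transposition` (§2),
* `firstCase_localTerm_eq_zero_of_cross_of_sign_transposition`, `…_of_sign_inclKD_transposition` (§3).
Next file (this seat): the transposition twins of `…RTCrossPairProvenance(Socket)` and `ctOrthogonalAtTwo_of_frame` = X-ORTH∃ of (E4)⁺.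

References: [McCallumLMS1991] §4 Prop. 4.7, §5 Lemma 5.3, Thm. 5.4; [GrossLMS1991] §3 (3.1)–(3.3), §5 Prop. 5.4; [MilneADT2006] I §6 proof of
Prop. 6.9; [Howard2004HeegnerKolyvagin] Lemma 1.5.3; [Kolyvagin1991StructureSha].
-/

set_option autoImplicit false

noncomputable section

open scoped Classical
open scoped AddSubgroup
open Function Field NumberField IsDedekindDomain WeierstrassCurve
open Literature.NumberTheory.EllipticCurves Literature.NumberTheory.GaloisRepresentations
open Literature.NumberTheory.GaloisCohomology
open Literature.NumberTheory.GaloisRepresentations.DiscreteGaloisModule (mu)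
open Literature.NumberTheory.Automorphic
open Summit.BirchSwinnertonDyer.Rank1Residual.X11b.Relaxation
open Summit.BirchSwinnertonDyer.Rank1Residual.JET.GlobalDuality

-- the Theorems namespace of this sub repeats the summit name by design (D-0017 nested layout)
set_option linter.dupNamespace false

namespace Summit.BirchSwinnertonDyer.BirchSwinnertonDyer.Theorems.GenusExact.PlusDescent

variable (W : WeierstrassCurve ℚ) (K : Type) [Field K] [NumberField K] [W.IsElliptic] [W.IsGloballyMinimal]

/-! ## §1 The cross-sign local vanishing at a transposition-deep place (twins of `…RTCrossSignLocalVanishing` §3) -/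

/-- **THE CROSS-SIGN LOCAL VANISHING AT A TRANSPOSITION-DEEP KOLYVAGIN PLACE, modulo `q` (assembled; sign-free twin of
`invWeilPairing_kummer_localization_eq_zero_of_conjActPlace_add_zsmul_eq`).**  `K` imaginary quadratic with `τ ≠ 1`, `τ² = 1`; `E/ℚ` globally minimal
(ANY sign of `Δ`); `ℓ` a Zhang–Kolyvagin prime at `2` with `1 ≤ M ≤ M(ℓ)` whose Frobenius MOVES A POINT OF `E[2]` (so that `E[2^M]` is the REGULAR
`⟨τ̃_*⟩`-module, `exists_regular_frame_liftAutPlace_of_transposition`); `λ ∋ ℓ`, `τ•λ = λ`; `e` a Weil datum on `E_K[2^M]` equivariant for the adapted lift,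
`inv` conj-compatible.  For a GLOBAL class `x` with `τ_* x = s·x` whose localisation is killed by `q`, and LOCAL Kummer classes `Y, Y′ ∈ 𝓛_λ` with
`σ_*Y + s·Y = q·Y′`:  **`inv_λ(Y ∪ₑ loc_λ x) = 0` and `inv_λ(loc_λ x ∪ₑ Y) = 0`.**  (Proof adapted verbatim from the `Δ < 0` original, gk2-p4 g20: the ONE
sign-dependent input — the regular frame — is replaced by its transposition version.)
[cite: McCallumLMS1991, §4 Prop. 4.7, §5 Lemma 5.3] [cite: GrossLMS1991, §3 (3.3)] [cite: Howard2004HeegnerKolyvagin, Lemma 1.5.3] -/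
theorem invWeilPairing_kummer_localization_eq_zero_of_conjActPlace_add_zsmul_eq_transposition (hK : IsImaginaryQuadratic K)
    {M ℓ : ℕ} (hM : 1 ≤ M)
    (hℓ : Zhang2014.IsKolyvaginPrime (W.conductorNorm ℤ) W K 2 ℓ) (hk : M ≤ Zhang2014.kolyvaginIndex W 2 ℓ)
    (hR : ∃ (v : HeightOneSpectrum (𝓞 ℚ)) (𝔓 : Ideal (absIntegers (𝓞 ℚ) ℚ)) (h : absoluteGaloisGroup ℚ),
      (ℓ : 𝓞 ℚ) ∈ v.asIdeal ∧ 𝔓 ∈ v.primesAbove ∧ IsArithFrobAt (𝓞 ℚ) h 𝔓 ∧ ∃ u : geomTorsion W 2, h • u ≠ u)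
    (w : HeightOneSpectrum (𝓞 K)) (hw : (ℓ : 𝓞 K) ∈ w.asIdeal)
    {τ : K ≃ₐ[ℚ] K} (hτ1 : τ ≠ 1) (hττ : τ * τ = 1) (hfix : τ • w = w)
    (e : (W.baseChange K).geomTorsion ((2 ^ M : ℕ) : ℤ) → (W.baseChange K).geomTorsion ((2 ^ M : ℕ) : ℤ) → AlgebraicClosure K)
    (hμ : ∀ S T, e S T ^ (2 ^ M) = 1)
    (hadd₁ : ∀ S₁ S₂ T, e (S₁ + S₂) T = e S₁ T * e S₂ T)
    (hadd₂ : ∀ S T₁ T₂, e S (T₁ + T₂) = e S T₁ * e S T₂)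
    (hgal : ∀ (γ : absoluteGaloisGroup K) (S T : (W.baseChange K).geomTorsion ((2 ^ M : ℕ) : ℤ)), γ • e S T = e (γ • S) (γ • T))
    (halt : ∀ T, e T T = 1)
    (hte : ∀ S T, e ((isLiftOfAut_liftAutPlace τ hfix).torsionMap W ((2 ^ M : ℕ) : ℤ) S)
      ((isLiftOfAut_liftAutPlace τ hfix).torsionMap W ((2 ^ M : ℕ) : ℤ) T) = liftAutPlace τ hfix (e S T))
    (inv : LocalInvariants K (2 ^ M)) (hinvc : inv.IsConjCompatible τ)
    {x : galoisCohomology ((W.baseChange K).torsionGaloisModule ((2 ^ M : ℕ) : ℤ)) 1} {s q : ℤ}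
    (hx : conjAct W τ ((2 ^ M : ℕ) : ℤ) x = s • x)
    (hqx : q • galoisCohomology.localization ((W.baseChange K).torsionGaloisModule ((2 ^ M : ℕ) : ℤ)) (Sum.inr w : Place K) 1 x = 0)
    {Y Y' : galoisCohomology (((W.baseChange K).torsionGaloisModule ((2 ^ M : ℕ) : ℤ)).toLocal (Sum.inr w : Place K)) 1}
    (hY : Y ∈ (W.baseChange K).kummerSelmerStructure ((2 ^ M : ℕ) : ℤ) (Sum.inr w))
    (hY' : Y' ∈ (W.baseChange K).kummerSelmerStructure ((2 ^ M : ℕ) : ℤ) (Sum.inr w))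
    (hσY : conjActPlace W τ ((2 ^ M : ℕ) : ℤ) hfix Y + s • Y = q • Y') :
    invWeilPairing (W.baseChange K) (2 ^ M) e hμ hadd₁ hadd₂ hgal inv (Sum.inr w) Y
        (galoisCohomology.localization ((W.baseChange K).torsionGaloisModule ((2 ^ M : ℕ) : ℤ)) (Sum.inr w : Place K) 1 x) = 0 ∧
      invWeilPairing (W.baseChange K) (2 ^ M) e hμ hadd₁ hadd₂ hgal inv (Sum.inr w)
        (galoisCohomology.localization ((W.baseChange K).torsionGaloisModule ((2 ^ M : ℕ) : ℤ)) (Sum.inr w : Place K) 1 x) Y = 0 := by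
  set loc := galoisCohomology.localization ((W.baseChange K).torsionGaloisModule ((2 ^ M : ℕ) : ℤ)) (Sum.inr w : Place K) 1
    with hloc
  set σ := conjActPlace W τ ((2 ^ M : ℕ) : ℤ) hfix with hσdef
  set t := (isLiftOfAut_liftAutPlace τ hfix).torsionMap W ((2 ^ M : ℕ) : ℤ) with htdef
  -- good reduction and `2 ∉ λ`
  obtain ⟨hgood, hpw⟩ := hasGoodReductionAt_of_zhangKolyvaginPrime W K hℓ w hw 1
  have hpw' : ((2 : ℕ) : 𝓞 K) ∉ w.asIdeal := by rwa [pow_one, Int.cast_natCast] at hpw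
  -- the `τ`-structure: `σ` involutive and preserving the pairing
  have hσ : ∀ X, σ (σ X) = X := fun X ↦ conjActPlace_conjActPlace_self W τ (2 ^ M) hττ hfix X
  have hσb := invWeilPairing_conjActPlace_self W τ (2 ^ M) e hμ hadd₁ hadd₂ hgal hfix hte inv hinvc
  -- the unramified parametrisation and the regular frame
  obtain ⟨unr, hunr0, -, hLunr, hunr⟩ :=
    exists_unramified_parametrization_kummer W K hK hℓ hk w hw hpw' hgood τ hfix
  obtain ⟨Q₀, htor, hspan, hfree, ht⟩ := exists_regular_frame_liftAutPlace_of_transposition W K hK hM hℓ hk hR w hw hτ1 hfix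
  -- the localisation of the global `s`-eigenclass is a `σ`-eigenclass of sign `s`
  have hX : σ (loc x) = s • loc x := by
    rw [hσdef, hloc, conjActPlace_localization_self W τ (2 ^ M) hfix x, hx, map_zsmul]
  have h1 := invWeilPairing_kummer_eq_zero_of_conj_add_zsmul_eq (W.baseChange K) M e hμ hadd₁ hadd₂ hgal w inv t ht σ hσ hσb unr
    hunr hLunr hunr0 Q₀ hspan hfree htor hY hY' hσY hX hqx
  exact ⟨h1, by rw [invWeilPairing_comm (W.baseChange K) M e hμ hadd₁ hadd₂ hgal halt w inv]; exact h1⟩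

/-- **Opposite signs pair to zero at a transposition-deep Kolyvagin place (assembled; `q = 0`; sign-free twin).**  Same frame; `τ_* x = s·x` global,
`Y ∈ 𝓛_λ` local with `σ_*Y = −(s·Y)`:  `inv_λ(Y ∪ₑ loc_λ x) = 0` and `inv_λ(loc_λ x ∪ₑ Y) = 0`. (Proof adapted from the `Δ < 0` original, gk2-p4 g20.)
[cite: McCallumLMS1991, §5 Lemma 5.3] [cite: Howard2004HeegnerKolyvagin, Lemma 1.5.3] -/
theorem invWeilPairing_kummer_localization_eq_zero_of_opposite_signs_transposition (hK : IsImaginaryQuadratic K)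
    {M ℓ : ℕ} (hM : 1 ≤ M)
    (hℓ : Zhang2014.IsKolyvaginPrime (W.conductorNorm ℤ) W K 2 ℓ) (hk : M ≤ Zhang2014.kolyvaginIndex W 2 ℓ)
    (hR : ∃ (v : HeightOneSpectrum (𝓞 ℚ)) (𝔓 : Ideal (absIntegers (𝓞 ℚ) ℚ)) (h : absoluteGaloisGroup ℚ),
      (ℓ : 𝓞 ℚ) ∈ v.asIdeal ∧ 𝔓 ∈ v.primesAbove ∧ IsArithFrobAt (𝓞 ℚ) h 𝔓 ∧ ∃ u : geomTorsion W 2, h • u ≠ u)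
    (w : HeightOneSpectrum (𝓞 K)) (hw : (ℓ : 𝓞 K) ∈ w.asIdeal)
    {τ : K ≃ₐ[ℚ] K} (hτ1 : τ ≠ 1) (hττ : τ * τ = 1) (hfix : τ • w = w)
    (e : (W.baseChange K).geomTorsion ((2 ^ M : ℕ) : ℤ) → (W.baseChange K).geomTorsion ((2 ^ M : ℕ) : ℤ) → AlgebraicClosure K)
    (hμ : ∀ S T, e S T ^ (2 ^ M) = 1)
    (hadd₁ : ∀ S₁ S₂ T, e (S₁ + S₂) T = e S₁ T * e S₂ T)
    (hadd₂ : ∀ S T₁ T₂, e S (T₁ + T₂) = e S T₁ * e S T₂)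
    (hgal : ∀ (γ : absoluteGaloisGroup K) (S T : (W.baseChange K).geomTorsion ((2 ^ M : ℕ) : ℤ)), γ • e S T = e (γ • S) (γ • T))
    (halt : ∀ T, e T T = 1)
    (hte : ∀ S T, e ((isLiftOfAut_liftAutPlace τ hfix).torsionMap W ((2 ^ M : ℕ) : ℤ) S)
      ((isLiftOfAut_liftAutPlace τ hfix).torsionMap W ((2 ^ M : ℕ) : ℤ) T) = liftAutPlace τ hfix (e S T))
    (inv : LocalInvariants K (2 ^ M)) (hinvc : inv.IsConjCompatible τ)
    {x : galoisCohomology ((W.baseChange K).torsionGaloisModule ((2 ^ M : ℕ) : ℤ)) 1} {s : ℤ}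
    (hx : conjAct W τ ((2 ^ M : ℕ) : ℤ) x = s • x)
    {Y : galoisCohomology (((W.baseChange K).torsionGaloisModule ((2 ^ M : ℕ) : ℤ)).toLocal (Sum.inr w : Place K)) 1}
    (hY : Y ∈ (W.baseChange K).kummerSelmerStructure ((2 ^ M : ℕ) : ℤ) (Sum.inr w))
    (hσY : conjActPlace W τ ((2 ^ M : ℕ) : ℤ) hfix Y = -(s • Y)) :
    invWeilPairing (W.baseChange K) (2 ^ M) e hμ hadd₁ hadd₂ hgal inv (Sum.inr w) Y
        (galoisCohomology.localization ((W.baseChange K).torsionGaloisModule ((2 ^ M : ℕ) : ℤ)) (Sum.inr w : Place K) 1 x) = 0 ∧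
      invWeilPairing (W.baseChange K) (2 ^ M) e hμ hadd₁ hadd₂ hgal inv (Sum.inr w)
        (galoisCohomology.localization ((W.baseChange K).torsionGaloisModule ((2 ^ M : ℕ) : ℤ)) (Sum.inr w : Place K) 1 x) Y = 0 := by
  have hσY' : conjActPlace W τ ((2 ^ M : ℕ) : ℤ) hfix Y + s • Y = (0 : ℤ) • (0 : _) := by rw [hσY, neg_add_cancel, zero_smul]
  exact invWeilPairing_kummer_localization_eq_zero_of_conjActPlace_add_zsmul_eq_transposition W K hK hM hℓ hk hR w hw hτ1 hττ hfix e hμ hadd₁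
    hadd₂ hgal halt hte inv hinvc hx (by rw [zero_smul]) hY (AddSubgroup.zero_mem _) hσY'

/-! ## §2 At the Cassels–Tate level `m·m = 2^M` (twins of `…RTCrossPairVanishing` §3) -/

/-- The transposition cross-sign vanishing transported to a level `N = 2^M` given as a variable (so that it applies VERBATIM at the Cassels–Tate
level `N = m·m`). (Sign-free twin; proof adapted from the `Δ < 0` original, gk2-p4 g20.) [cite: McCallumLMS1991, §5 Lemma 5.3] -/
theorem invWeilPairing_kummer_localization_eq_zero_of_conjActPlace_add_zsmul_eq_of_level_eq_transposition {N : ℕ} [NeZero N] {M : ℕ}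
    (hN : N = 2 ^ M)
    (hK : IsImaginaryQuadratic K) {ℓ : ℕ} (hM : 1 ≤ M)
    (hℓ : Zhang2014.IsKolyvaginPrime (W.conductorNorm ℤ) W K 2 ℓ) (hk : M ≤ Zhang2014.kolyvaginIndex W 2 ℓ)
    (hR : ∃ (v : HeightOneSpectrum (𝓞 ℚ)) (𝔓 : Ideal (absIntegers (𝓞 ℚ) ℚ)) (h : absoluteGaloisGroup ℚ),
      (ℓ : 𝓞 ℚ) ∈ v.asIdeal ∧ 𝔓 ∈ v.primesAbove ∧ IsArithFrobAt (𝓞 ℚ) h 𝔓 ∧ ∃ u : geomTorsion W 2, h • u ≠ u)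
    (w : HeightOneSpectrum (𝓞 K)) (hw : (ℓ : 𝓞 K) ∈ w.asIdeal)
    {τ : K ≃ₐ[ℚ] K} (hτ1 : τ ≠ 1) (hττ : τ * τ = 1) (hfix : τ • w = w)
    (e : (W.baseChange K).geomTorsion ((N : ℕ) : ℤ) → (W.baseChange K).geomTorsion ((N : ℕ) : ℤ) → AlgebraicClosure K)
    (hμ : ∀ S T, e S T ^ N = 1)
    (hadd₁ : ∀ S₁ S₂ T, e (S₁ + S₂) T = e S₁ T * e S₂ T)
    (hadd₂ : ∀ S T₁ T₂, e S (T₁ + T₂) = e S T₁ * e S T₂)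
    (hgal : ∀ (γ : absoluteGaloisGroup K) (S T : (W.baseChange K).geomTorsion ((N : ℕ) : ℤ)), γ • e S T = e (γ • S) (γ • T))
    (halt : ∀ T, e T T = 1)
    (hte : ∀ S T, e ((isLiftOfAut_liftAutPlace τ hfix).torsionMap W ((N : ℕ) : ℤ) S)
      ((isLiftOfAut_liftAutPlace τ hfix).torsionMap W ((N : ℕ) : ℤ) T) = liftAutPlace τ hfix (e S T))
    (inv : LocalInvariants K N) (hinvc : inv.IsConjCompatible τ)
    {x : galoisCohomology ((W.baseChange K).torsionGaloisModule ((N : ℕ) : ℤ)) 1} {s q : ℤ}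
    (hx : conjAct W τ ((N : ℕ) : ℤ) x = s • x)
    (hqx : q • galoisCohomology.localization ((W.baseChange K).torsionGaloisModule ((N : ℕ) : ℤ)) (Sum.inr w : Place K) 1 x = 0)
    {Y Y' : galoisCohomology (((W.baseChange K).torsionGaloisModule ((N : ℕ) : ℤ)).toLocal (Sum.inr w : Place K)) 1}
    (hY : Y ∈ (W.baseChange K).kummerSelmerStructure ((N : ℕ) : ℤ) (Sum.inr w))
    (hY' : Y' ∈ (W.baseChange K).kummerSelmerStructure ((N : ℕ) : ℤ) (Sum.inr w))
    (hσY : conjActPlace W τ ((N : ℕ) : ℤ) hfix Y + s • Y = q • Y') :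
    invWeilPairing (W.baseChange K) N e hμ hadd₁ hadd₂ hgal inv (Sum.inr w) Y
        (galoisCohomology.localization ((W.baseChange K).torsionGaloisModule ((N : ℕ) : ℤ)) (Sum.inr w : Place K) 1 x) = 0 ∧
      invWeilPairing (W.baseChange K) N e hμ hadd₁ hadd₂ hgal inv (Sum.inr w)
        (galoisCohomology.localization ((W.baseChange K).torsionGaloisModule ((N : ℕ) : ℤ)) (Sum.inr w : Place K) 1 x) Y = 0 := by
  subst hN
  exact invWeilPairing_kummer_localization_eq_zero_of_conjActPlace_add_zsmul_eq_transposition W K hK hM hℓ hk hR w hw hτ1 hττ hfix e hμ hadd₁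
    hadd₂ hgal halt hte inv hinvc hx hqx hY hY' hσY

/-- **THE CROSS LOCAL TERM IS ZERO at a transposition-deep place (sign-free twin of `firstCase_localTerm_eq_zero_of_cross`).**  Cassels–Tate level
`m` with `m·m = 2^M`; `λ ∋ ℓ` a Zhang–Kolyvagin place of index `≥ M ≥ 1` whose Frobenius moves a point of `E[2]`, `τ•λ = λ`; `e` lift-equivariant,
`inv` conj-compatible; a first-case datum `D` whose global lift `b₁` is a `τ_*`-eigenclass of sign `s` with `m • loc_λ b₁ = 0` and whose Kummer lift
`β′_λ` is `(−s)`-eigen modulo `m·𝓛_λ`.  Then `t_λ(D) = 0`. (Proof adapted from the `Δ < 0` original, gk2-p4 g20.)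
[cite: McCallumLMS1991, §4 Prop. 4.7, §5 Lemma 5.3] [cite: Howard2004HeegnerKolyvagin, Lemma 1.5.3] -/
theorem firstCase_localTerm_eq_zero_of_cross_transposition {m M : ℕ} [NeZero m] [NeZero (m * m)] (hmm : m * m = 2 ^ M)
    (hK : IsImaginaryQuadratic K) {ℓ : ℕ} (hM : 1 ≤ M)
    (hℓ : Zhang2014.IsKolyvaginPrime (W.conductorNorm ℤ) W K 2 ℓ) (hk : M ≤ Zhang2014.kolyvaginIndex W 2 ℓ)
    (hR : ∃ (v : HeightOneSpectrum (𝓞 ℚ)) (𝔓 : Ideal (absIntegers (𝓞 ℚ) ℚ)) (h : absoluteGaloisGroup ℚ),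
      (ℓ : 𝓞 ℚ) ∈ v.asIdeal ∧ 𝔓 ∈ v.primesAbove ∧ IsArithFrobAt (𝓞 ℚ) h 𝔓 ∧ ∃ u : geomTorsion W 2, h • u ≠ u)
    (w : HeightOneSpectrum (𝓞 K)) (hw : (ℓ : 𝓞 K) ∈ w.asIdeal)
    {τ : K ≃ₐ[ℚ] K} (hτ1 : τ ≠ 1) (hττ : τ * τ = 1) (hfix : τ • w = w)
    (e : (W.baseChange K).geomTorsion ((m * m : ℕ) : ℤ) → (W.baseChange K).geomTorsion ((m * m : ℕ) : ℤ) → AlgebraicClosure K)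
    (hμ : ∀ S T, e S T ^ (m * m) = 1)
    (hadd₁ : ∀ S₁ S₂ T, e (S₁ + S₂) T = e S₁ T * e S₂ T)
    (hadd₂ : ∀ S T₁ T₂, e S (T₁ + T₂) = e S T₁ * e S T₂)
    (hgal : ∀ (γ : absoluteGaloisGroup K) (S T : (W.baseChange K).geomTorsion ((m * m : ℕ) : ℤ)), γ • e S T = e (γ • S) (γ • T))
    (halt : ∀ T, e T T = 1)
    (hte : ∀ S T, e ((isLiftOfAut_liftAutPlace τ hfix).torsionMap W ((m * m : ℕ) : ℤ) S)
      ((isLiftOfAut_liftAutPlace τ hfix).torsionMap W ((m * m : ℕ) : ℤ) T) = liftAutPlace τ hfix (e S T))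
    (inv : LocalInvariants K (m * m)) (hinvc : inv.IsConjCompatible τ)
    (D : FirstCaseData (W.baseChange K) m) {s : ℤ}
    (hb₁ : conjAct W τ ((m * m : ℕ) : ℤ) D.b₁ = s • D.b₁)
    (hmb₁ : (m : ℤ) • galoisCohomology.localization ((W.baseChange K).torsionGaloisModule ((m * m : ℕ) : ℤ)) (Sum.inr w : Place K) 1
      D.b₁ = 0)
    {βw Y' : galoisCohomology (((W.baseChange K).torsionGaloisModule ((m * m : ℕ) : ℤ)).toLocal (Sum.inr w : Place K)) 1}
    (hβw : βw = D.β' (Sum.inr w))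
    (hY' : Y' ∈ (W.baseChange K).kummerSelmerStructure ((m * m : ℕ) : ℤ) (Sum.inr w))
    (hσβ' : conjActPlace W τ ((m * m : ℕ) : ℤ) hfix βw + s • βw = (m : ℤ) • Y') :
    D.localTerm e hμ hadd₁ hadd₂ hgal inv (Sum.inr w) = 0 := by
  have hβmem : βw ∈ (W.baseChange K).kummerSelmerStructure ((m * m : ℕ) : ℤ) (Sum.inr w) := hβw ▸ D.β'_mem (Sum.inr w)
  rw [firstCase_localTerm_eq_invWeilPairing_localization e hμ hadd₁ hadd₂ hgal halt inv D (Sum.inr w)]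
  have h := (invWeilPairing_kummer_localization_eq_zero_of_conjActPlace_add_zsmul_eq_of_level_eq_transposition W K hmm hK hM hℓ hk hR w hw hτ1
    hττ hfix e hμ hadd₁ hadd₂ hgal halt hte inv hinvc hb₁ hmb₁ hβmem hY' hσβ').2
  rwa [hβw] at h

/-! ## §3 Signs on the datum / on `ι_* b′` (twins of `…RTCrossPairTerm` §1) -/

/-- **THE CROSS LOCAL TERM IS ZERO (signs on the datum; transposition-deep place; sign-free twin).**  As `firstCase_localTerm_eq_zero_of_cross_transposition`
with `τ_* b₁ = s·b₁`, `m • loc_λ b₁ = 0` and `τ_* b′ = −(s·b′)` on the datum. (Proof adapted from the `Δ < 0` original, gk2-p4 g20.)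
[cite: McCallumLMS1991, §4 Prop. 4.7, §5 Lemma 5.3] [cite: Howard2004HeegnerKolyvagin, Lemma 1.5.3] -/
theorem firstCase_localTerm_eq_zero_of_cross_of_sign_transposition {m M : ℕ} [NeZero m] [NeZero (m * m)] (hmm : m * m = 2 ^ M)
    (hK : IsImaginaryQuadratic K) {ℓ : ℕ} (hM : 1 ≤ M)
    (hℓ : Zhang2014.IsKolyvaginPrime (W.conductorNorm ℤ) W K 2 ℓ) (hk : M ≤ Zhang2014.kolyvaginIndex W 2 ℓ)
    (hR : ∃ (v : HeightOneSpectrum (𝓞 ℚ)) (𝔓 : Ideal (absIntegers (𝓞 ℚ) ℚ)) (h : absoluteGaloisGroup ℚ),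
      (ℓ : 𝓞 ℚ) ∈ v.asIdeal ∧ 𝔓 ∈ v.primesAbove ∧ IsArithFrobAt (𝓞 ℚ) h 𝔓 ∧ ∃ u : geomTorsion W 2, h • u ≠ u)
    (w : HeightOneSpectrum (𝓞 K)) (hw : (ℓ : 𝓞 K) ∈ w.asIdeal)
    {τ : K ≃ₐ[ℚ] K} (hτ1 : τ ≠ 1) (hττ : τ * τ = 1) (hfix : τ • w = w)
    (e : (W.baseChange K).geomTorsion ((m * m : ℕ) : ℤ) → (W.baseChange K).geomTorsion ((m * m : ℕ) : ℤ) → AlgebraicClosure K)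
    (hμ : ∀ S T, e S T ^ (m * m) = 1)
    (hadd₁ : ∀ S₁ S₂ T, e (S₁ + S₂) T = e S₁ T * e S₂ T)
    (hadd₂ : ∀ S T₁ T₂, e S (T₁ + T₂) = e S T₁ * e S T₂)
    (hgal : ∀ (γ : absoluteGaloisGroup K) (S T : (W.baseChange K).geomTorsion ((m * m : ℕ) : ℤ)), γ • e S T = e (γ • S) (γ • T))
    (halt : ∀ T, e T T = 1)
    (hte : ∀ S T, e ((isLiftOfAut_liftAutPlace τ hfix).torsionMap W ((m * m : ℕ) : ℤ) S)
      ((isLiftOfAut_liftAutPlace τ hfix).torsionMap W ((m * m : ℕ) : ℤ) T) = liftAutPlace τ hfix (e S T))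
    (inv : LocalInvariants K (m * m)) (hinvc : inv.IsConjCompatible τ)
    (D : FirstCaseData (W.baseChange K) m) {s : ℤ}
    (hb₁ : conjAct W τ ((m * m : ℕ) : ℤ) D.b₁ = s • D.b₁)
    (hmb₁ : (m : ℤ) • galoisCohomology.localization ((W.baseChange K).torsionGaloisModule ((m * m : ℕ) : ℤ)) (Sum.inr w : Place K) 1
      D.b₁ = 0)
    (hb' : conjAct W τ (m : ℤ) D.b' = -(s • D.b')) :
    D.localTerm e hμ hadd₁ hadd₂ hgal inv (Sum.inr w) = 0 := by
  obtain ⟨Y', hY', hEq⟩ := exists_mem_kummer_conjActPlace_add_smul_eq_zsmul W K hfix D hb' (D.β' (Sum.inr w)) rfl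
  exact firstCase_localTerm_eq_zero_of_cross_transposition W K hmm hK hM hℓ hk hR w hw hτ1 hττ hfix e hμ hadd₁ hadd₂ hgal halt hte inv hinvc D hb₁
    hmb₁ rfl hY' hEq

/-- **THE CROSS LOCAL TERM IS ZERO (sign read on `t = ι_* b′`; transposition-deep place; sign-free twin).**  As
`firstCase_localTerm_eq_zero_of_cross_of_sign_transposition`, with the sign of the second class given on `t := ι_* D.b′ ∈ H¹(K, E[m²])` and `E[m]`
without non-zero `Γ_K`-fixed points. (Proof adapted from the `Δ < 0` original, gk2-p4 g20.)
[cite: McCallumLMS1991, §4 Prop. 4.7, §5 Lemma 5.3] [cite: GrossLMS1991, §5 Prop. 5.4] -/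
theorem firstCase_localTerm_eq_zero_of_cross_of_sign_inclKD_transposition {m M : ℕ} [NeZero m] [NeZero (m * m)] (hmm : m * m = 2 ^ M)
    (hK : IsImaginaryQuadratic K) {ℓ : ℕ} (hM : 1 ≤ M)
    (hℓ : Zhang2014.IsKolyvaginPrime (W.conductorNorm ℤ) W K 2 ℓ) (hk : M ≤ Zhang2014.kolyvaginIndex W 2 ℓ)
    (hR : ∃ (v : HeightOneSpectrum (𝓞 ℚ)) (𝔓 : Ideal (absIntegers (𝓞 ℚ) ℚ)) (h : absoluteGaloisGroup ℚ),
      (ℓ : 𝓞 ℚ) ∈ v.asIdeal ∧ 𝔓 ∈ v.primesAbove ∧ IsArithFrobAt (𝓞 ℚ) h 𝔓 ∧ ∃ u : geomTorsion W 2, h • u ≠ u)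
    (w : HeightOneSpectrum (𝓞 K)) (hw : (ℓ : 𝓞 K) ∈ w.asIdeal)
    {τ : K ≃ₐ[ℚ] K} (hτ1 : τ ≠ 1) (hττ : τ * τ = 1) (hfix : τ • w = w)
    (e : (W.baseChange K).geomTorsion ((m * m : ℕ) : ℤ) → (W.baseChange K).geomTorsion ((m * m : ℕ) : ℤ) → AlgebraicClosure K)
    (hμ : ∀ S T, e S T ^ (m * m) = 1)
    (hadd₁ : ∀ S₁ S₂ T, e (S₁ + S₂) T = e S₁ T * e S₂ T)
    (hadd₂ : ∀ S T₁ T₂, e S (T₁ + T₂) = e S T₁ * e S T₂)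
    (hgal : ∀ (γ : absoluteGaloisGroup K) (S T : (W.baseChange K).geomTorsion ((m * m : ℕ) : ℤ)), γ • e S T = e (γ • S) (γ • T))
    (halt : ∀ T, e T T = 1)
    (hte : ∀ S T, e ((isLiftOfAut_liftAutPlace τ hfix).torsionMap W ((m * m : ℕ) : ℤ) S)
      ((isLiftOfAut_liftAutPlace τ hfix).torsionMap W ((m * m : ℕ) : ℤ) T) = liftAutPlace τ hfix (e S T))
    (inv : LocalInvariants K (m * m)) (hinvc : inv.IsConjCompatible τ)
    (hnofix : ∀ P : geomTorsion (W.baseChange K) (m : ℤ), (∀ g : absoluteGaloisGroup K, g • P = P) → P = 0)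
    (D : FirstCaseData (W.baseChange K) m) {s : ℤ}
    (hb₁ : conjAct W τ ((m * m : ℕ) : ℤ) D.b₁ = s • D.b₁)
    (hmb₁ : (m : ℤ) • galoisCohomology.localization ((W.baseChange K).torsionGaloisModule ((m * m : ℕ) : ℤ)) (Sum.inr w : Place K) 1
      D.b₁ = 0)
    {t : galoisCohomology ((W.baseChange K).torsionGaloisModule ((m * m : ℕ) : ℤ)) 1}
    (hDt : galoisCohomology.map (inclKD (W.baseChange K) m m) 1 D.b' = t) (ht : conjAct W τ ((m * m : ℕ) : ℤ) t = -(s • t)) :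
    D.localTerm e hμ hadd₁ hadd₂ hgal inv (Sum.inr w) = 0 := by
  have ht' : conjAct W τ ((m * m : ℕ) : ℤ) t = (-s) • t := by rw [ht, neg_smul]
  have hb' : conjAct W τ (m : ℤ) D.b' = -(s • D.b') := by
    rw [conjAct_eq_smul_of_map_inclKD_eq W τ m hnofix hDt ht', neg_smul]
  exact firstCase_localTerm_eq_zero_of_cross_of_sign_transposition W K hmm hK hM hℓ hk hR w hw hτ1 hττ hfix e hμ hadd₁ hadd₂ hgal halt hte inv hinvc
    D hb₁ hmb₁ hb'

end Summit.BirchSwinnertonDyer.BirchSwinnertonDyer.Theorems.GenusExact.PlusDescent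

end
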